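import Summits.MatrixMultiplication.MatrixMultiplication.Theses.GLnSeparatingDesigns

/-!
# Split-design barrier for `BorderHalfDimensionDesigns` — strategist sketch (statements only)

Crux `stmt-MatrixMultiplication-18360` (route `GLnSeparatingDesigns`).  NEGATION lens.

**Theorem (split-design barrier).**  Let `n ≥ 3`, `s ≥ 2`, `H₁, H₂ ≤ GL_n(ℂ)` ANY subgroups,
`χ₁, χ₂` scalar functions, `X ⊆ H₁`, `Z⁻¹ ⊆ H₂`, `Y` finite.  Suppose
1. (targets readable) for every target `(x₀,z₀)` a polynomial of degree `≤ s` in the entries takes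
   the value `[x = x₀ ∧ z = z₀]` at `x z⁻¹` (`x ∈ X`, `z ∈ Z`) — automatic from any separating family
   at `y = y'`;
2. (split middle test) some `p₀` of degree `≤ s` is left-`(H₁,χ₁)`- and right-`(H₂,χ₂)`-semi-invariant
   on `GL_n(ℂ)` and its Gram matrix `(p₀(y⁻¹y'))_{y,y' ∈ Y}` is nonsingular — e.g. `p₀(1) ≠ 0`,
   `p₀ = 0` on `Y⁻¹Y ∖ 1` (BCGPU Lemma 2.11's `p₀ ∈ Inv_{X,Z}`, exact or `1+O(ε)`/`O(ε)`).
Then `|X|·|Y|·|Z| ≤ (max_{|λ| ≤ s} dim V_λ) · C(2s+n², n²) ≤ s^{n(n-1)/2} · C(2s+n², n²)`.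

Proof (3 steps, see Lines/… card / STRATEGY-CENSUS.md §Negation):
(i)  `|X||Z| · dim SI_{≤s} ≤ C(2s+n²,n²)` where `SI` = bi-semi-invariants of degree `≤ s`:
     if `f₁..f_a ∈ Pol_{≤s}` are independent as functions on `H₁H₂ ⊇ XZ⁻¹` (`a ≥ |X||Z|` by 1.) and
     `g₁..g_b` is a basis of `SI_{≤s}`, the products `f_i g_j ∈ Pol_{≤2s}` are independent: on the
     Zariski-open set `U ∋ 1` of `w` for which the `f_i` stay independent on `H₁ w H₂`, each `g_j` is
     the constant `χ₁χ₂·g_j(w)`, so a relation `Σ c_ij f_i g_j = 0` gives `Σ_j c_ij g_j(w) = 0` on `U`,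
     hence `c = 0` (a polynomial vanishing on a nonempty Zariski-open subset of `Mat_n` is zero).
(ii) `|Y| ≤ (max dim V_λ) · dim SI_{≤s}`: the Gram matrix has rows in the span of the translates
     `ρ_g p₀`; by `ℂ[Mat_n]_k = ⊕_{λ ⊢ k} V_λ^* ⊠ V_λ` the `λ`-component `p_λ` of `p₀` lies in
     `(V_λ^*)^{(H₁,χ₁)} ⊗ V_λ^{(H₂,χ₂)}`, has tensor rank `≤ a_λ b_λ`, and its translates span
     `≤ d_λ · a_λ b_λ` dimensions; sum over `λ`: `≤ d_max · Σ a_λ b_λ = d_max · dim SI_{≤s}`;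
     `d_λ ≤ s^{C(n,2)}` is BCGPU Lemma 2.7 = tree `stub_finrank_irreducible_le`.
(iii) multiply (i) and (ii); `dim SI` cancels.

Corollary: sizes `q^{n²/2-εn}` at degree `q^{1+δ}` force `ε ≥ 1/6 - δn/2 - o(1)`; and through
Cor. 2.8 a split design certifies only `ω ≤ 3·(log D − 2C log s)/(log D + n² log 2 − 2C log s) → 3`.
-/

set_option linter.dupNamespace false

namespace Summit.MatrixMultiplication.MatrixMultiplication.Cruxes.BorderHalfDimensionDesigns.SplitBarrier

open scoped BigOperators Matrix
open Summit.MatrixMultiplication.MatrixMultiplication.Theses.GLnSeparatingDesigns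

/-- Shorthand for the host group `GL_n(ℂ)`. -/
abbrev GLn (n : ℕ) := Matrix.GeneralLinearGroup (Fin n) ℂ

/-- The entries of a group element, as the evaluation point the crux uses. -/
def ent {n : ℕ} (g : GLn n) : Fin n × Fin n → ℂ :=
  fun ij => (g : Matrix (Fin n) (Fin n) ℂ) ij.1 ij.2

/-- FIRST LEMMA of the negation line (statement; proof = steps (i)–(iii) of the module docstring):
the **split-design barrier**.  Any design whose outer sets sit in subgroups `H₁ ∋ x`, `H₂ ∋ z⁻¹`
and whose middle test `p₀` is `(H₁,χ₁;H₂,χ₂)`-bi-semi-invariant with nonsingular Gram matrix on `Y`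
has volume `|X||Y||Z| ≤ s^{n(n-1)/2} · C(2s+n², n²)`. -/
theorem stub_splitDesign_volume_le {n s : ℕ} (hn : 3 ≤ n) (hs : 2 ≤ s)
    (H₁ H₂ : Subgroup (GLn n)) (χ₁ χ₂ : GLn n → ℂ)
    (X Y Z : Finset (GLn n))
    (hX : ∀ x ∈ X, x ∈ H₁) (hZ : ∀ z ∈ Z, z⁻¹ ∈ H₂)
    (hsepXZ : ∀ x₀ ∈ X, ∀ z₀ ∈ Z, ∃ r : MvPolynomial (Fin n × Fin n) ℂ, r.totalDegree ≤ s ∧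
      ∀ x ∈ X, ∀ z ∈ Z,
        MvPolynomial.eval (ent (x * z⁻¹)) r = if x = x₀ ∧ z = z₀ then 1 else 0)
    (p₀ : MvPolynomial (Fin n × Fin n) ℂ) (hp₀ : p₀.totalDegree ≤ s)
    (hleft : ∀ h ∈ H₁, ∀ g : GLn n,
      MvPolynomial.eval (ent (h * g)) p₀ = χ₁ h * MvPolynomial.eval (ent g) p₀)
    (hright : ∀ h ∈ H₂, ∀ g : GLn n,
      MvPolynomial.eval (ent (g * h)) p₀ = χ₂ h * MvPolynomial.eval (ent g) p₀)
    (hGram : (Matrix.of fun y y' : ↥Y => MvPolynomial.eval (ent (y.1⁻¹ * y'.1)) p₀).det ≠ 0) :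
    X.card * Y.card * Z.card ≤ s ^ (n * (n - 1) / 2) * (2 * s + n ^ 2).choose (n ^ 2) := by
  sorry

/-- Step (i) alone (elementary; no representation theory): outer capacity times the dimension of
the bi-semi-invariants is at most `dim Pol_{≤2s}`.  `SI` is given extensionally as a finite
independent family `g` of bi-semi-invariant polynomials of degree `≤ s`. -/
theorem stub_outer_times_invariants_le {n s b : ℕ}
    (H₁ H₂ : Subgroup (GLn n)) (χ₁ χ₂ : GLn n → ℂ)
    (X Z : Finset (GLn n))
    (hX : ∀ x ∈ X, x ∈ H₁) (hZ : ∀ z ∈ Z, z⁻¹ ∈ H₂)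
    (hsepXZ : ∀ x₀ ∈ X, ∀ z₀ ∈ Z, ∃ r : MvPolynomial (Fin n × Fin n) ℂ, r.totalDegree ≤ s ∧
      ∀ x ∈ X, ∀ z ∈ Z,
        MvPolynomial.eval (ent (x * z⁻¹)) r = if x = x₀ ∧ z = z₀ then 1 else 0)
    (g : Fin b → MvPolynomial (Fin n × Fin n) ℂ) (hg : LinearIndependent ℂ g)
    (hgdeg : ∀ j, (g j).totalDegree ≤ s)
    (hgleft : ∀ j, ∀ h ∈ H₁, ∀ w : GLn n,
      MvPolynomial.eval (ent (h * w)) (g j) = χ₁ h * MvPolynomial.eval (ent w) (g j))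
    (hgright : ∀ j, ∀ h ∈ H₂, ∀ w : GLn n,
      MvPolynomial.eval (ent (w * h)) (g j) = χ₂ h * MvPolynomial.eval (ent w) (g j)) :
    X.card * Z.card * b ≤ (2 * s + n ^ 2).choose (n ^ 2) := by
  sorry

/-- Step (ii) alone: the Gram bound for a bi-semi-invariant middle test (BCGPU Lemma 2.7 supplies
`dim V_λ ≤ s^{C(n,2)}`; `b` = the dimension of the bi-semi-invariants of degree `≤ s`, given as the
cardinality of a spanning family). -/
theorem stub_gram_le {n s b : ℕ} (hn : 3 ≤ n) (hs : 2 ≤ s)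
    (H₁ H₂ : Subgroup (GLn n)) (χ₁ χ₂ : GLn n → ℂ) (Y : Finset (GLn n))
    (g : Fin b → MvPolynomial (Fin n × Fin n) ℂ)
    (hspan : ∀ p : MvPolynomial (Fin n × Fin n) ℂ, p.totalDegree ≤ s →
      (∀ h ∈ H₁, ∀ w : GLn n, MvPolynomial.eval (ent (h * w)) p = χ₁ h * MvPolynomial.eval (ent w) p) →
      (∀ h ∈ H₂, ∀ w : GLn n, MvPolynomial.eval (ent (w * h)) p = χ₂ h * MvPolynomial.eval (ent w) p) →
      (fun w : GLn n => MvPolynomial.eval (ent w) p) ∈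
        Submodule.span ℂ (Set.range fun j => fun w : GLn n => MvPolynomial.eval (ent w) (g j)))
    (p₀ : MvPolynomial (Fin n × Fin n) ℂ) (hp₀ : p₀.totalDegree ≤ s)
    (hleft : ∀ h ∈ H₁, ∀ w : GLn n,
      MvPolynomial.eval (ent (h * w)) p₀ = χ₁ h * MvPolynomial.eval (ent w) p₀)
    (hright : ∀ h ∈ H₂, ∀ w : GLn n,
      MvPolynomial.eval (ent (w * h)) p₀ = χ₂ h * MvPolynomial.eval (ent w) p₀)
    (hGram : (Matrix.of fun y y' : ↥Y => MvPolynomial.eval (ent (y.1⁻¹ * y'.1)) p₀).det ≠ 0) :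
    Y.card ≤ s ^ (n * (n - 1) / 2) * b := by
  sorry

/-- The crux strengthened to SPLIT FORM (BCGPU §2.4 / Lemma 2.11 architecture: outer sets in
subgroups, one bi-semi-invariant middle test per tolerance).  The barrier refutes it. -/
def SplitBorderHalfDimensionDesigns : Prop :=
  ∀ ε : ℝ, 0 < ε → ∃ n : ℕ, 3 ≤ n ∧ ∀ δ : ℝ, 0 < δ → ∀ q₀ : ℕ, ∃ q : ℕ, q₀ ≤ q ∧ ∀ η : ℝ, 0 < η →
    ∃ X Y Z : Finset (GLn n),
      (q : ℝ) ^ ((n : ℝ) ^ 2 / 2 - ε * n) ≤ (X.card : ℝ) ∧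
      (q : ℝ) ^ ((n : ℝ) ^ 2 / 2 - ε * n) ≤ (Y.card : ℝ) ∧
      (q : ℝ) ^ ((n : ℝ) ^ 2 / 2 - ε * n) ≤ (Z.card : ℝ) ∧
      (∀ x₀ ∈ X, ∀ z₀ ∈ Z, ∃ p : MvPolynomial (Fin n × Fin n) ℂ,
        (p.totalDegree : ℝ) ≤ (q : ℝ) ^ (1 + δ) ∧
        ∀ x ∈ X, ∀ y ∈ Y, ∀ y' ∈ Y, ∀ z ∈ Z,
          ((x = x₀ ∧ y = y' ∧ z = z₀) → ‖MvPolynomial.eval (ent (x * y⁻¹ * y' * z⁻¹)) p - 1‖ ≤ η) ∧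
          (¬ (x = x₀ ∧ y = y' ∧ z = z₀) → ‖MvPolynomial.eval (ent (x * y⁻¹ * y' * z⁻¹)) p‖ ≤ η)) ∧
      -- the split structure
      ∃ (H₁ H₂ : Subgroup (GLn n)) (χ₁ χ₂ : GLn n → ℂ) (p₀ : MvPolynomial (Fin n × Fin n) ℂ),
        (∀ x ∈ X, x ∈ H₁) ∧ (∀ z ∈ Z, z⁻¹ ∈ H₂) ∧
        (p₀.totalDegree : ℝ) ≤ (q : ℝ) ^ (1 + δ) ∧
        (∀ h ∈ H₁, ∀ w : GLn n,
          MvPolynomial.eval (ent (h * w)) p₀ = χ₁ h * MvPolynomial.eval (ent w) p₀) ∧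
        (∀ h ∈ H₂, ∀ w : GLn n,
          MvPolynomial.eval (ent (w * h)) p₀ = χ₂ h * MvPolynomial.eval (ent w) p₀) ∧
        (Matrix.of fun y y' : ↥Y => MvPolynomial.eval (ent (y.1⁻¹ * y'.1)) p₀).det ≠ 0

/-- TARGET of the negation line: the split form of the crux is false (for `ε < 1/6` already). -/
theorem not_splitBorderHalfDimensionDesigns : ¬ SplitBorderHalfDimensionDesigns := by
  sorry

/-- Sanity glue (trivial direction): split designs are designs. -/
theorem borderHalfDimensionDesigns_of_split (h : SplitBorderHalfDimensionDesigns) :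
    BorderHalfDimensionDesigns := by
  intro ε hε
  obtain ⟨n, hn, H⟩ := h ε hε
  refine ⟨n, hn, fun δ hδ q₀ => ?_⟩
  obtain ⟨q, hq, Hq⟩ := H δ hδ q₀
  refine ⟨q, hq, fun η hη => ?_⟩
  obtain ⟨X, Y, Z, hX, hY, hZ, hsep, -⟩ := Hq (min η (1 / 4)) (lt_min hη (by norm_num))
  have hη4 : min η (1 / 4) ≤ η := min_le_left _ _
  refine ⟨X, Y, Z, ?_, hX, hY, hZ, ?_⟩
  · -- TPP from the separators at tolerance < 1/2 (refuter's `tpp_of_separators`, re-proved inline)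
    intro x hx x' hx' y hy y' hy' z hz z' hz' hmul
    by_contra hne
    obtain ⟨p, -, hp⟩ := hsep x' hx' z' hz'
    have h0 := (hp x hx y hy y' hy' z hz).2 hne
    have h1 := (hp x' hx' y hy y hy z' hz').1 ⟨rfl, rfl, rfl⟩
    have e : ent (x * y⁻¹ * y' * z⁻¹) = ent (x' * y⁻¹ * y * z'⁻¹) := by
      have e1 : x * y⁻¹ * y' * z⁻¹ = x' * y⁻¹ * y * z'⁻¹ := by rw [hmul]; group
      rw [e1]
    rw [e] at h0
    have h2 : (1 : ℝ) ≤ ‖(1 : ℂ) - MvPolynomial.eval (ent (x' * y⁻¹ * y * z'⁻¹)) p‖ +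
        ‖MvPolynomial.eval (ent (x' * y⁻¹ * y * z'⁻¹)) p‖ := by
      have := norm_sub_norm_le (1 : ℂ) ((1 : ℂ) - MvPolynomial.eval (ent (x' * y⁻¹ * y * z'⁻¹)) p)
      rw [norm_one, sub_sub_cancel] at this
      linarith
    rw [norm_sub_rev] at h1
    have h3 : min η (1 / 4) ≤ 1 / 4 := min_le_right _ _
    linarith
  · intro x₀ hx₀ z₀ hz₀
    obtain ⟨p, hpdeg, hp⟩ := hsep x₀ hx₀ z₀ hz₀
    refine ⟨p, hpdeg, fun x hx y hy y' hy' z hz => ⟨fun hc => ?_, fun hc => ?_⟩⟩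
    · exact ((hp x hx y hy y' hy' z hz).1 hc).trans hη4
    · exact ((hp x hx y hy y' hy' z hz).2 hc).trans hη4

end Summit.MatrixMultiplication.MatrixMultiplication.Cruxes.BorderHalfDimensionDesigns.SplitBarrier
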